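import Mathlib.Algebra.BigOperators.Ring.Finset
import Mathlib.Algebra.Ring.Int.Defs
import Mathlib.Data.Fintype.Basic
import HarnessLib

/-!
# Venture HSemireg — ADDITIVE ⇒ CLASS-DEAD from two finite regularities (THEOREM H, pad-pair form)

Companion to `FibrePartition.lean` (THEOREM F, k = 161) and `WeightedFibreCounterexample.lean`
(PROPOSITION H⁻): the WEIGHTED class question of door (I)'s fat paragraph (cell pub-hsemireg, seat
p2 gen 13, `p2/wlaws/WEIGHTED-LOCAL-p2g13.md` §9f).  There the following was found on every
THEOREM-F-clean skeleton support of record (K1x and three more, machine-exact): a weighting of the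
pieces that is ADDITIVE at every pad-pair curve `c` — the two pads carry the same total weight as the
two crossed triples, `wA (padA c) + wA' (padA' c) = wT (weil c) + wR (partner c)` — is CLASS-DEAD
(`∑_T φ T * wT T = 0` for every class functional `φ`), and the three-line hand proof uses only two
finite facts of the support: (i) every Weil triple lies on the same number `N ≠ 0` of pad-pair curves
and its crossed partner there is never Weil; (ii) every pad and every partner piece sees a
CLASS-BALANCED multiset of Weil triples along its curves (`∑_{c : padA c = p} φ (weil c) = 0`, etc.).
PROPOSITION H⁻ shows that some such global hypothesis is NECESSARY (THEOREM F's tier does not suffice).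

THIS FILE is the kernel form of that three-line argument, as abstract finite bookkeeping:
`C` = the pad-pair curves through Weil triples, `W` = Weil triples, `P`, `P'` = A-pads, A′-pads,
`Rp` = partner pieces; `weil`, `padA`, `padA'`, `partner` the incidence maps; integer weights.
`additive_class_dead`: (i) + (ii) + additivity ⇒ `N * ∑_T φ T * wT T = 0`, hence the class sum
vanishes when `N ≠ 0`.  The proof is the double count
`N·∑_T φ(T) wT(T) = ∑_c φ(weil c) wT(weil c) = ∑_c φ(weil c) (wA + wA' − wR) = 0`.

HONEST FRAMING. Finite sums only; the hypotheses (i)(ii) are regularities OF A GIVEN SUPPORT (they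
hold on the four F-clean skeletons of record with N = 144 and fail on the 12-piece model of H⁻); no
variety, cycle, cohomology class or semiregularity map occurs; nothing here bears on HC ∕ HC_CM ∕ HC_AV.
-/

namespace Summit.Ventures.HSemireg
namespace AdditiveClassDeath

open Finset

variable {C W P P' Rp : Type*} [Fintype C] [Fintype W] [Fintype P] [Fintype P'] [Fintype Rp]
  [DecidableEq W] [DecidableEq P] [DecidableEq P'] [DecidableEq Rp]

/-- Regrouping a sum over curves by the value of an incidence map (double counting). -/
theorem sum_by_fibre {X : Type*} [Fintype X] [DecidableEq X] (f : C → X) (g : C → ℤ) :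
    ∑ c, g c = ∑ x, ∑ c ∈ univ.filter (fun c => f c = x), g c := by
  rw [← sum_fiberwise_of_maps_to (s := (univ : Finset C)) (t := (univ : Finset X))
    (g := f) (fun c _ => mem_univ (f c))]

/-- **THEOREM H, pad-pair form (kernel).** If (i) every Weil triple `T` lies on exactly `N` curves
(`#{c | weil c = T} = N`), (ii) the Weil triples seen by each A-pad, each A′-pad and each partner
piece along its curves are class-balanced for the functional `φ` (the three `hbal` hypotheses), and
the weighting is additive at every curve, then `N * ∑_T φ T * wT T = 0`. -/
theorem additive_class_dead_mul (weil : C → W) (padA : C → P) (padA' : C → P') (partner : C → Rp)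
    (φ : W → ℤ) (wT : W → ℤ) (wA : P → ℤ) (wA' : P' → ℤ) (wR : Rp → ℤ) (N : ℕ)
    (hN : ∀ T : W, (univ.filter fun c => weil c = T).card = N)
    (hbalA : ∀ p : P, ∑ c ∈ univ.filter (fun c => padA c = p), φ (weil c) = 0)
    (hbalA' : ∀ p : P', ∑ c ∈ univ.filter (fun c => padA' c = p), φ (weil c) = 0)
    (hbalR : ∀ r : Rp, ∑ c ∈ univ.filter (fun c => partner c = r), φ (weil c) = 0)
    (hadd : ∀ c : C, wA (padA c) + wA' (padA' c) = wT (weil c) + wR (partner c)) :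
    (N : ℤ) * ∑ T, φ T * wT T = 0 := by
  -- (1) N · ∑_T φ(T) wT(T) = ∑_c φ(weil c) · wT(weil c)
  have h1 : (N : ℤ) * ∑ T, φ T * wT T = ∑ c, φ (weil c) * wT (weil c) := by
    rw [mul_sum, sum_by_fibre weil (fun c => φ (weil c) * wT (weil c))]
    refine sum_congr rfl fun T _ => ?_
    have : ∑ c ∈ univ.filter (fun c => weil c = T), φ (weil c) * wT (weil c)
        = ∑ c ∈ univ.filter (fun c => weil c = T), φ T * wT T := by
      refine sum_congr rfl fun c hc => ?_
      rw [(mem_filter.1 hc).2]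
    rw [this, sum_const, hN T, nsmul_eq_mul]
  -- (2) additivity curve by curve
  have h2 : ∑ c, φ (weil c) * wT (weil c)
      = ∑ c, φ (weil c) * wA (padA c) + ∑ c, φ (weil c) * wA' (padA' c)
        - ∑ c, φ (weil c) * wR (partner c) := by
    rw [← sum_add_distrib, ← sum_sub_distrib]
    refine sum_congr rfl fun c _ => ?_
    have := hadd c
    rw [← mul_add, ← mul_sub]
    congr 1
    omega
  -- (3) each of the three sums vanishes by class balance (regroup by the pad / partner)
  have h3 : ∑ c, φ (weil c) * wA (padA c) = 0 := by
    rw [sum_by_fibre padA]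
    refine sum_eq_zero fun p _ => ?_
    have : ∑ c ∈ univ.filter (fun c => padA c = p), φ (weil c) * wA (padA c)
        = ∑ c ∈ univ.filter (fun c => padA c = p), φ (weil c) * wA p := by
      refine sum_congr rfl fun c hc => ?_
      rw [(mem_filter.1 hc).2]
    rw [this, ← sum_mul, hbalA p, zero_mul]
  have h4 : ∑ c, φ (weil c) * wA' (padA' c) = 0 := by
    rw [sum_by_fibre padA']
    refine sum_eq_zero fun p _ => ?_
    have : ∑ c ∈ univ.filter (fun c => padA' c = p), φ (weil c) * wA' (padA' c)
        = ∑ c ∈ univ.filter (fun c => padA' c = p), φ (weil c) * wA' p := by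
      refine sum_congr rfl fun c hc => ?_
      rw [(mem_filter.1 hc).2]
    rw [this, ← sum_mul, hbalA' p, zero_mul]
  have h5 : ∑ c, φ (weil c) * wR (partner c) = 0 := by
    rw [sum_by_fibre partner]
    refine sum_eq_zero fun r _ => ?_
    have : ∑ c ∈ univ.filter (fun c => partner c = r), φ (weil c) * wR (partner c)
        = ∑ c ∈ univ.filter (fun c => partner c = r), φ (weil c) * wR r := by
      refine sum_congr rfl fun c hc => ?_
      rw [(mem_filter.1 hc).2]
    rw [this, ← sum_mul, hbalR r, zero_mul]
  rw [h1, h2, h3, h4, h5]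
  simp

/-- **THEOREM H, pad-pair form (kernel), conclusion.** Under (i), (ii) and additivity with `N ≠ 0`
the weighted class sum `∑_T φ T * wT T` vanishes: the weighting is class-dead for `φ`. -/
theorem additive_class_dead (weil : C → W) (padA : C → P) (padA' : C → P') (partner : C → Rp)
    (φ : W → ℤ) (wT : W → ℤ) (wA : P → ℤ) (wA' : P' → ℤ) (wR : Rp → ℤ) (N : ℕ) (hN0 : N ≠ 0)
    (hN : ∀ T : W, (univ.filter fun c => weil c = T).card = N)
    (hbalA : ∀ p : P, ∑ c ∈ univ.filter (fun c => padA c = p), φ (weil c) = 0)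
    (hbalA' : ∀ p : P', ∑ c ∈ univ.filter (fun c => padA' c = p), φ (weil c) = 0)
    (hbalR : ∀ r : Rp, ∑ c ∈ univ.filter (fun c => partner c = r), φ (weil c) = 0)
    (hadd : ∀ c : C, wA (padA c) + wA' (padA' c) = wT (weil c) + wR (partner c)) :
    ∑ T, φ T * wT T = 0 := by
  have h := additive_class_dead_mul weil padA padA' partner φ wT wA wA' wR N hN hbalA hbalA' hbalR hadd
  rcases mul_eq_zero.1 h with h0 | h0
  · exact absurd (by exact_mod_cast h0) hN0
  · exact h0

end AdditiveClassDeath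
end Summit.Ventures.HSemireg
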